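import Mathlib
import HarnessLib
import Summits.NavierStokesRegularity.NavierStokesRegularity.Theorems.ChiralWindowDoorDefs
import Summits.NavierStokesRegularity.NavierStokesRegularity.Theorems.CriticalFluxDoorDefs
import Summits.NavierStokesRegularity.NavierStokesRegularity.Theorems.ChiralWindowDoorGagliardoIdentity
import Summits.NavierStokesRegularity.NavierStokesRegularity.Theorems.ChiralWindowDoorLocalHelicityLower
import Summits.NavierStokesRegularity.NavierStokesRegularity.Theorems.ChiralWindowDoorLocalDissipationPointwise
import Summits.NavierStokesRegularity.NavierStokesRegularity.Theorems.ChiralWindowDoorLocalDissipationLower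
import Summits.NavierStokesRegularity.NavierStokesRegularity.Theorems.ChiralWindowDoorTimeIntegratedError
import Summits.NavierStokesRegularity.NavierStokesRegularity.Theorems.PoloidalWindowDoorPoloidalWindowRigidityWindow
import Summits.NavierStokesRegularity.NavierStokesRegularity.Theorems.CriticalFluxDoorDerivSlice

/-!
# Door S21-C «CriticalFluxDoor» — stub F2 `stub_critDissipationLower` PROVED: the windowed critical DISSIPATION of a
# door-class profile is almost coercive, integrated in time, uniformly in `R`

Door S21-C of nsreg-p1's local Type-I door family (`HOME/ns-regularity-ideate-p1/ROUND-20.md` §2b F2, texts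
`r20/Sketch21v3.lean` 389107c39cb1e66c; DESIGN-ONLY, route NOT born).  For a door-class profile `v` (the five classical
binders) and the weights `a_R = η(·/R)²`:

  `∑ᵢ ∫_{t<t₀} G(a_R, ∂ᵢv(t)) dt ≤ ∑ᵢ ∫_{t<t₀} Q(a_R, ∂ᵢv(t)) dt + c`   (`R > 0`, `t₀ < 0`; `c` independent of both),

`G = gagliardo` (windowed Gagliardo form), `Q = critEnergy` (windowed critical energy `∫a⟪f, Λf⟫`), `∂ᵢ = pderiv i`.
Pointwise in `t` this is S20's B2′ mechanism WITHOUT chirality: the Gagliardo–`Λ` IDENTITY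
`G(a_R, f) = Q(a_R, f) − ½∫‖f‖²Λa_R` (`…GagliardoIdentity.gagliardo_eq_integral_sub`) for `f = ∂ᵢv(t)` (decay package
`…CriticalFluxDoorDerivSlice.pderiv_slice_package`), the decay bookkeeping `|∫‖∂ᵢv‖²Λa_R| ≤ L₁²·E_R(t)`
(`…LocalDissipationPointwise.integral_normSq_vorticity_mul_abs_fracLapHalfS_le`, `E_R(t) = R²∫(R‖y‖+√(−t))⁻⁴|Λa₁(y)|dy`) and
the time integral `∫_{t<0}E_R ≤ c₁(η)` (`…TimeIntegratedError.timeIntegratedError_le`).  Both time integrals in the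
statement are GENUINE: `t ↦ Q(a_R, ∂ᵢv(t))` is integrable on `(−∞,t₀)` (`…DerivSlice.integrableOn_critEnergy_pderiv`) and
so is the error `t ↦ ∫‖∂ᵢv(t)‖²Λa_R` (`integrableOn_normSq_pderiv_fracLapHalfS`, this file), hence so is `G`.

* `integrableOn_normSq_pderiv_fracLapHalfS` — the error term is integrable on `(−∞,t₀)` with `∫|·| ≤ L₁²c₁(η)`;
* `integral_gagliardo_pderiv_le` — per direction: `∫_{t<t₀} G(a_R,∂ᵢv) ≤ ∫_{t<t₀} Q(a_R,∂ᵢv) + ½L₁²c₁(η)`;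
* `critDissipationLower` — **stub F2 of `r20/Sketch21v3.lean` = hypothesis `hF2` of the tree's
  `…CriticalFluxDoorTargetOfF2F3.target_of_F2_F3` (text verbatim), PROVED** (`c = (3/2)L₁²c₁(η)`).

Seat nsreg-p6 g13 (THEOREMS-ONLY door sequels, DIRECTOR-NS g8 #32 (2)/#36).  WHAT THIS IS NOT: not NS regularity (Clay A);
pure kinematics of the door class (no equation structure beyond the class bounds); S21-C stays a door modulo F3
`stub_critEnergyBudget`; no route is opened.
-/

noncomputable section

-- the summit and its single sub-problem share the name (CONVENTIONS §1), as in every Theorems file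
set_option linter.dupNamespace false

namespace Summit.NavierStokesRegularity.NavierStokesRegularity.Theorems.CriticalFluxDoorCritDissipationLower

open MeasureTheory Metric Set Filter Topology Function
open scoped RealInnerProductSpace
open Literature.Analysis Literature.Analysis.FluidPDE
open Summit.NavierStokesRegularity.NavierStokesRegularity.Theorems.ChiralWindowDoorDefs
open Summit.NavierStokesRegularity.NavierStokesRegularity.Theorems.CriticalFluxDoorDefs
open Summit.NavierStokesRegularity.NavierStokesRegularity.Theorems.ChiralWindowDoorGagliardoIdentity
  (gagliardo_eq_integral_sub)
open Summit.NavierStokesRegularity.NavierStokesRegularity.Theorems.ChiralWindowDoorLocalHelicityLower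
  (continuous_bumpSq exists_secondDiff_bound_bumpSq fracLapHalfS_bumpSq_scale)
open Summit.NavierStokesRegularity.NavierStokesRegularity.Theorems.ChiralWindowDoorLocalDissipationPointwise
  (integral_normSq_vorticity_mul_abs_fracLapHalfS_le)
open Summit.NavierStokesRegularity.NavierStokesRegularity.Theorems.ChiralWindowDoorLocalDissipationLower
  (contDiffOn_uncurry_fderiv_slice prod_restrict_Iio)
open Summit.NavierStokesRegularity.NavierStokesRegularity.Theorems.ChiralWindowDoorTimeIntegratedError
  (continuous_fracLapHalfS_bumpSq_one timeIntegratedError_le)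
open Summit.NavierStokesRegularity.NavierStokesRegularity.Theorems.PoloidalWindowDoorPoloidalWindowRigidityWindow
  (isTypeIAncientMild_of_class)
open Summit.NavierStokesRegularity.NavierStokesRegularity.Theorems.CriticalFluxDoorDerivSlice
  (pderiv_slice_package integrableOn_critEnergy_pderiv)

variable {C D : ℝ} {v : ℝ → EuclideanSpace ℝ (Fin 3) → EuclideanSpace ℝ (Fin 3)} {η : EuclideanSpace ℝ (Fin 3) → ℝ}

/-! ### The error term `t ↦ ∫‖∂ᵢv(t)‖² Λa_R` -/

/-- `Λ a_R` is continuous (`R > 0`; scaling to `Λ a₁`). -/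
theorem continuous_fracLapHalfS_bumpSq (hη : IsAdmissibleBump η) {R : ℝ} (hR : 0 < R) :
    Continuous (fracLapHalfS (bumpSq η R)) := by
  have h : fracLapHalfS (bumpSq η R) = fun x => R⁻¹ * fracLapHalfS (bumpSq η 1) (R⁻¹ • x) :=
    funext fun x => fracLapHalfS_bumpSq_scale η hR x
  rw [h]
  exact continuous_const.mul ((continuous_fracLapHalfS_bumpSq_one hη).comp (continuous_const_smul R⁻¹))

/-- **`t ↦ ∫‖∂ᵢv(t)‖² Λa_R` is a.e.-strongly measurable on `(−∞,t₀)`, `t₀ ≤ 0`** (jointly continuous integrand). -/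
theorem aestronglyMeasurable_normSq_pderiv_fracLapHalfS (hv : ContDiffOn ℝ 2 (uncurry v) (Iio (0 : ℝ) ×ˢ univ))
    (hη : IsAdmissibleBump η) {R : ℝ} (hR : 0 < R) {t₀ : ℝ} (ht₀ : t₀ ≤ 0) (i : Fin 3) :
    AEStronglyMeasurable (fun t => ∫ x, ‖pderiv i (v t) x‖ ^ 2 * fracLapHalfS (bumpSq η R) x)
      (volume.restrict (Iio t₀)) := by
  set S : Set (ℝ × EuclideanSpace ℝ (Fin 3)) := Iio t₀ ×ˢ univ with hS
  have hSm : MeasurableSet S := measurableSet_Iio.prod MeasurableSet.univ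
  have hsub : S ⊆ Iio (0 : ℝ) ×ˢ univ := prod_mono (Iio_subset_Iio ht₀) subset_rfl
  have hPc : ContinuousOn (fun q : ℝ × EuclideanSpace ℝ (Fin 3) => pderiv i (v q.1) q.2) S := by
    have h := ((contDiffOn_uncurry_fderiv_slice (m := 0) hv (by norm_num)).continuousOn).mono hsub
    have h' : ContinuousOn (fun q : ℝ × EuclideanSpace ℝ (Fin 3) =>
        fderiv ℝ (v q.1) q.2 (EuclideanSpace.single i 1)) S := h.clm_apply continuousOn_const
    exact h'.congr fun q _ => pderiv_eq i (v q.1) q.2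
  have hF : ContinuousOn (fun q : ℝ × EuclideanSpace ℝ (Fin 3) =>
      ‖pderiv i (v q.1) q.2‖ ^ 2 * fracLapHalfS (bumpSq η R) q.2) S :=
    (hPc.norm.pow 2).mul ((continuous_fracLapHalfS_bumpSq hη hR).comp continuous_snd).continuousOn
  have hFm : AEStronglyMeasurable (fun q : ℝ × EuclideanSpace ℝ (Fin 3) =>
      ‖pderiv i (v q.1) q.2‖ ^ 2 * fracLapHalfS (bumpSq η R) q.2) (((volume : Measure ℝ).restrict (Iio t₀)).prod volume) := by
    rw [prod_restrict_Iio]; exact hF.aestronglyMeasurable hSm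
  exact hFm.integral_prod_right'

/-- **The F2 error term is integrable on `(−∞,t₀)` with `∫_{t<t₀}|∫‖∂ᵢv(t)‖²Λa_R| ≤ L₁²c₁(η)`** (`t₀ < 0`, `R > 0`),
`c₁(η) = ∫‖y‖⁻²|Λa₁(y)|dy`, for a door-class profile whose derivative slices decay like `L₁/(‖x‖+√(−t))²`. -/
theorem integrableOn_normSq_pderiv_fracLapHalfS (hη : IsAdmissibleBump η) (hrate : HasTypeITimeDecay C v)
    (hcont : ContinuousOn (Function.uncurry v) (Set.Iio (0 : ℝ) ×ˢ Set.univ))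
    (hmild : ∀ s t : ℝ, s < t → t < 0 → ∀ x,
      v t x = UnboundedOperators.heatExtension (v s) (t - s) x - oseenDuhamel 1 s v v t x)
    (hdiv : ∀ t < 0, VectorCalculus.IsDivFree (v t)) {L₁ : ℝ}
    (hdec : ∀ t < (0 : ℝ), ∀ (i : Fin 3) (x : EuclideanSpace ℝ (Fin 3)),
      ‖pderiv i (v t) x‖ ≤ L₁ / (‖x‖ + Real.sqrt (-t)) ^ 2)
    {R : ℝ} (hR : 0 < R) {t₀ : ℝ} (ht₀ : t₀ < 0) (i : Fin 3) :
    IntegrableOn (fun t => ∫ x, ‖pderiv i (v t) x‖ ^ 2 * fracLapHalfS (bumpSq η R) x) (Iio t₀) ∧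
      ∫ t in Iio t₀, |∫ x, ‖pderiv i (v t) x‖ ^ 2 * fracLapHalfS (bumpSq η R) x| ≤
        L₁ ^ 2 * ∫ y : EuclideanSpace ℝ (Fin 3), ‖y‖ ^ (-(2 : ℝ)) * |fracLapHalfS (bumpSq η 1) y| := by
  set c₁ : ℝ := ∫ y : EuclideanSpace ℝ (Fin 3), ‖y‖ ^ (-(2 : ℝ)) * |fracLapHalfS (bumpSq η 1) y| with hc₁
  set E : ℝ → ℝ := fun t => R ^ 2 * ∫ y : EuclideanSpace ℝ (Fin 3),
    ((R * ‖y‖ + Real.sqrt (-t)) ^ 4)⁻¹ * |fracLapHalfS (bumpSq η 1) y| with hE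
  set F : ℝ → ℝ := fun t => ∫ x, ‖pderiv i (v t) x‖ ^ 2 * fracLapHalfS (bumpSq η R) x with hF
  have hsmooth : ContDiffOn ℝ 2 (uncurry v) (Iio (0 : ℝ) ×ˢ univ) :=
    (isTypeIAncientMild_of_class hrate hcont hmild hdiv).1.of_le (by norm_cast)
  -- the time-integrated error
  obtain ⟨hEi0, hEval0⟩ := timeIntegratedError_le hη hR
  have hEnn : ∀ t, 0 ≤ E t := fun t => by
    rw [hE]; exact mul_nonneg (sq_nonneg R) (integral_nonneg fun y => by positivity)
  have hsubset : Iio t₀ ⊆ Iio (0 : ℝ) := Iio_subset_Iio ht₀.le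
  have hEi : IntegrableOn E (Iio t₀) := hEi0.mono_set hsubset
  have hEval : ∫ t in Iio t₀, E t ≤ c₁ :=
    (setIntegral_mono_set hEi0 (ae_of_all _ hEnn) (ae_of_all _ hsubset)).trans hEval0
  -- the pointwise bound `|F t| ≤ L₁² E t` on `t < 0`
  have hbd : ∀ t < (0 : ℝ), |F t| ≤ L₁ ^ 2 * E t := by
    intro t ht
    have hsq : 0 < Real.sqrt (-t) := Real.sqrt_pos.2 (neg_pos.2 ht)
    obtain ⟨-, hbook⟩ := integral_normSq_vorticity_mul_abs_fracLapHalfS_le hη hsq (fun x => hdec t ht i x) hR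
    refine le_trans ?_ hbook
    rw [hF]
    refine abs_integral_le_integral_abs.trans_eq (integral_congr_ae (Eventually.of_forall fun x => ?_))
    show |‖pderiv i (v t) x‖ ^ 2 * fracLapHalfS (bumpSq η R) x| = ‖pderiv i (v t) x‖ ^ 2 * |fracLapHalfS (bumpSq η R) x|
    rw [abs_mul, abs_of_nonneg (by positivity : (0 : ℝ) ≤ ‖pderiv i (v t) x‖ ^ 2)]
  have hFm : AEStronglyMeasurable F (volume.restrict (Iio t₀)) :=
    aestronglyMeasurable_normSq_pderiv_fracLapHalfS hsmooth hη hR ht₀.le i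
  have hFi : IntegrableOn F (Iio t₀) := by
    refine Integrable.mono' (hEi.const_mul (L₁ ^ 2)) hFm ((ae_restrict_iff' measurableSet_Iio).2
      (ae_of_all _ fun t ht => ?_))
    rw [Real.norm_eq_abs]
    exact hbd t (lt_trans ht ht₀)
  refine ⟨hFi, ?_⟩
  calc ∫ t in Iio t₀, |F t| ≤ ∫ t in Iio t₀, L₁ ^ 2 * E t :=
        setIntegral_mono_on hFi.abs (hEi.const_mul (L₁ ^ 2)) measurableSet_Iio fun t ht => hbd t (lt_trans ht ht₀)
    _ = L₁ ^ 2 * ∫ t in Iio t₀, E t := integral_const_mul _ _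
    _ ≤ L₁ ^ 2 * c₁ := mul_le_mul_of_nonneg_left hEval (sq_nonneg L₁)

/-! ### Per-direction F2 -/

/-- **F2 per direction**: for a door-class profile, `R > 0`, `t₀ < 0` and each `i`,
`∫_{t<t₀} G(a_R, ∂ᵢv(t)) dt ≤ ∫_{t<t₀} Q(a_R, ∂ᵢv(t)) dt + ½ L₁² c₁(η)` — the Gagliardo–`Λ` identity for the slice
`∂ᵢv(t)` (so `G = Q − ½∫‖∂ᵢv‖²Λa_R` EXACTLY), with all three time integrals genuine. -/
theorem integral_gagliardo_pderiv_le (hη : IsAdmissibleBump η) (hrate : HasTypeITimeDecay C v)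
    (hdecay : HasTypeIDecay D v) (hcont : ContinuousOn (Function.uncurry v) (Set.Iio (0 : ℝ) ×ˢ Set.univ))
    (hmild : ∀ s t : ℝ, s < t → t < 0 → ∀ x,
      v t x = UnboundedOperators.heatExtension (v s) (t - s) x - oseenDuhamel 1 s v v t x)
    (hdiv : ∀ t < 0, VectorCalculus.IsDivFree (v t)) {L₁ L₃ : ℝ}
    (hpkg : ∀ t < (0 : ℝ), ∀ i : Fin 3,
      ContDiff ℝ 2 (pderiv i (v t)) ∧
      (∀ x, ‖pderiv i (v t) x‖ ≤ L₁ / (‖x‖ + Real.sqrt (-t)) ^ 2) ∧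
      (∀ x, ‖fderiv ℝ (fderiv ℝ (pderiv i (v t))) x‖ ≤ L₃ / (‖x‖ + Real.sqrt (-t)) ^ 4) ∧
      ∃ N₀ N₁ N₂ : ℝ, Continuous (pderiv i (v t)) ∧ (∀ x, ‖pderiv i (v t) x‖ ≤ N₀) ∧
        (∀ x y, ‖pderiv i (v t) x - pderiv i (v t) y‖ ≤ N₁ * ‖x - y‖) ∧
        ∀ x z, ‖(2 : ℝ) • pderiv i (v t) x - pderiv i (v t) (x + z) - pderiv i (v t) (x - z)‖ ≤ N₂ * ‖z‖ ^ 2)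
    {R : ℝ} (hR : 0 < R) {t₀ : ℝ} (ht₀ : t₀ < 0) (i : Fin 3) :
    ∫ t in Iio t₀, gagliardo (bumpSq η R) (pderiv i (v t)) ≤
      (∫ t in Iio t₀, critEnergy (bumpSq η R) (pderiv i (v t))) +
        (1 / 2 : ℝ) * L₁ ^ 2 * ∫ y : EuclideanSpace ℝ (Fin 3), ‖y‖ ^ (-(2 : ℝ)) * |fracLapHalfS (bumpSq η 1) y| := by
  set c₁ : ℝ := ∫ y : EuclideanSpace ℝ (Fin 3), ‖y‖ ^ (-(2 : ℝ)) * |fracLapHalfS (bumpSq η 1) y| with hc₁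
  set G : ℝ → ℝ := fun t => gagliardo (bumpSq η R) (pderiv i (v t)) with hG
  set Qf : ℝ → ℝ := fun t => critEnergy (bumpSq η R) (pderiv i (v t)) with hQf
  set F : ℝ → ℝ := fun t => ∫ x, ‖pderiv i (v t) x‖ ^ 2 * fracLapHalfS (bumpSq η R) x with hF
  show ∫ t in Iio t₀, G t ≤ (∫ t in Iio t₀, Qf t) + 1 / 2 * L₁ ^ 2 * c₁
  -- the weight package
  have hac : Continuous (bumpSq η R) := continuous_bumpSq hη R
  have hann : ∀ x, 0 ≤ bumpSq η R x := bumpSq_nonneg η R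
  have ha0 : ∀ x, |bumpSq η R x| ≤ 1 := fun x => by
    rw [abs_of_nonneg (hann x)]; exact bumpSq_le_one hη R x
  obtain ⟨A₂, hA₂⟩ := exists_secondDiff_bound_bumpSq hη hR
  have hρ : 0 < 2 * R := by positivity
  have hsupp : ∀ x : EuclideanSpace ℝ (Fin 3), 2 * R ≤ ‖x‖ → bumpSq η R x = 0 := fun x hx => bumpSq_eq_zero hη hR hx
  -- the pointwise identity `G t = Q t − ½ F t` on `t < 0`
  have hid : ∀ t < (0 : ℝ), G t = Qf t - (1 / 2 : ℝ) * F t := by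
    intro t ht
    obtain ⟨-, -, -, N₀, N₁, N₂, hfc, hf0, hf1, hf2⟩ := hpkg t ht i
    have h := gagliardo_eq_integral_sub hac hann ha0 hA₂ hρ hsupp hfc hf0 hf1 hf2
    rw [hG, hQf, hF]; dsimp only
    rw [h, critEnergy_eq]
  -- integrability of `Q` and `F`
  have hQi : IntegrableOn Qf (Iio t₀) := integrableOn_critEnergy_pderiv hη hrate hdecay hcont hmild hdiv hR ht₀ i
  obtain ⟨hFi, hFval⟩ := integrableOn_normSq_pderiv_fracLapHalfS hη hrate hcont hmild hdiv
    (fun t ht j x => (hpkg t ht j).2.1 x) hR ht₀ i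
  -- `∫ G = ∫ Q − ½ ∫ F`
  have hGeq : ∫ t in Iio t₀, G t = (∫ t in Iio t₀, Qf t) - (1 / 2 : ℝ) * ∫ t in Iio t₀, F t := by
    have h1 : ∫ t in Iio t₀, G t = ∫ t in Iio t₀, (Qf t - (1 / 2 : ℝ) * F t) :=
      setIntegral_congr_fun measurableSet_Iio fun t ht => hid t (lt_trans ht ht₀)
    rw [h1, integral_sub hQi (hFi.const_mul _), integral_const_mul]
  rw [hGeq]
  have hFabs : -(∫ t in Iio t₀, F t) ≤ ∫ t in Iio t₀, |F t| := by
    rw [← integral_neg]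
    exact integral_mono hFi.neg hFi.abs fun t => neg_le_abs (F t)
  have hc : (1 / 2 : ℝ) * L₁ ^ 2 * c₁ = (1 / 2 : ℝ) * (L₁ ^ 2 * c₁) := by ring
  rw [hc]
  linarith [hFval, hFabs]

/-! ### Stub F2 -/

/-- **Stub F2 `stub_critDissipationLower` of nsreg-p1 `r20/Sketch21v3.lean` (= hypothesis `hF2` of the tree's
`…CriticalFluxDoorTargetOfF2F3.target_of_F2_F3`, text verbatim), PROVED — THE WINDOWED CRITICAL DISSIPATION OF A
DOOR-CLASS PROFILE IS ALMOST COERCIVE, integrated in time, uniformly in `R`.**  `c = (3/2)·L₁²·c₁(η)` with `L₁` the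
scale-invariant size of `∇v` and `c₁(η) = ∫‖y‖⁻²|Λa₁(y)|dy`. -/
theorem critDissipationLower : ∀ (η : EuclideanSpace ℝ (Fin 3) → ℝ), IsAdmissibleBump η → ∀ (C D : ℝ)
    (v : ℝ → EuclideanSpace ℝ (Fin 3) → EuclideanSpace ℝ (Fin 3)),
    HasTypeITimeDecay C v → HasTypeIDecay D v →
    ContinuousOn (Function.uncurry v) (Set.Iio (0 : ℝ) ×ˢ Set.univ) →
    (∀ s t : ℝ, s < t → t < 0 → ∀ x,
        v t x = UnboundedOperators.heatExtension (v s) (t - s) x - oseenDuhamel 1 s v v t x) →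
    (∀ t < 0, VectorCalculus.IsDivFree (v t)) →
    ∃ c : ℝ, ∀ R > (0 : ℝ), ∀ t₀ < (0 : ℝ),
      ∑ i : Fin 3, ∫ t in Set.Iio t₀, gagliardo (bumpSq η R) (pderiv i (v t)) ≤
        (∑ i : Fin 3, ∫ t in Set.Iio t₀, critEnergy (bumpSq η R) (pderiv i (v t))) + c := by
  intro η hη C D v hrate hdecay hcont hmild hdiv
  obtain ⟨L₁, L₃, hL₁, hL₃, hpkg⟩ := pderiv_slice_package hrate hdecay hcont hmild hdiv
  set c₁ : ℝ := ∫ y : EuclideanSpace ℝ (Fin 3), ‖y‖ ^ (-(2 : ℝ)) * |fracLapHalfS (bumpSq η 1) y| with hc₁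
  refine ⟨3 * ((1 / 2 : ℝ) * L₁ ^ 2 * c₁), fun R hR t₀ ht₀ => ?_⟩
  have key : ∀ i : Fin 3, ∫ t in Iio t₀, gagliardo (bumpSq η R) (pderiv i (v t)) ≤
      (∫ t in Iio t₀, critEnergy (bumpSq η R) (pderiv i (v t))) + (1 / 2 : ℝ) * L₁ ^ 2 * c₁ := fun i =>
    integral_gagliardo_pderiv_le hη hrate hdecay hcont hmild hdiv hpkg hR ht₀ i
  calc ∑ i : Fin 3, ∫ t in Iio t₀, gagliardo (bumpSq η R) (pderiv i (v t))
      ≤ ∑ i : Fin 3, ((∫ t in Iio t₀, critEnergy (bumpSq η R) (pderiv i (v t))) + (1 / 2 : ℝ) * L₁ ^ 2 * c₁) :=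
        Finset.sum_le_sum fun i _ => key i
    _ = (∑ i : Fin 3, ∫ t in Iio t₀, critEnergy (bumpSq η R) (pderiv i (v t))) + 3 * ((1 / 2 : ℝ) * L₁ ^ 2 * c₁) := by
        rw [Finset.sum_add_distrib, Finset.sum_const, Finset.card_univ, Fintype.card_fin]
        simp

end Summit.NavierStokesRegularity.NavierStokesRegularity.Theorems.CriticalFluxDoorCritDissipationLower

end
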